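import Literature.AlgebraicGeometry.Frobenioids.PerfectionUntrCommuteUnconditional
import Literature.AlgebraicGeometry.Frobenioids.UnitTrivializationPerfectionModelLiteralElem
import Literature.AlgebraicGeometry.Frobenioids.ArithmeticRealificationInstance
import Literature.AlgebraicGeometry.Frobenioids.ArithmeticFrobenioidThm64iVariants
import Literature.AlgebraicGeometry.Frobenioids.ElementaryNatIsoTransport
import HarnessLib

/-!
# Frobenioids I, Prop. 5.3 / Thm. 6.4 (iii): THE comparison functor `((C_{K/F})^pf)^un-tr → C_{K/F}^rlf`
# with its base isomorphism and Div-clause (row «T64iii COMPARISON FUNCTORS AT THE DATA»)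

Mochizuki, *The geometry of Frobenioids I: the general theory*, Kyushu J. Math. **62** (2008) 293–400, §5,
Proposition 5.3, kurims p. 103 ll. 22–27, verbatim: "In particular, if `C` is of Frobenius-isotropic type, then
there is a natural 1-commutative diagram of functors `C → C^istr → C^pf` / `C^un-tr → (C^un-tr)^pf → C^rlf` [where the
functor `C → C^istr` is the isotropification functor of Proposition 1.9, (v); the remaining functors are the
functors that arise naturally from the construction of the 'unit-trivialization', 'perfection', and
'realification']"; Proposition 5.5 (ii) p. 104 ll. 33–35, verbatim: "There is a natural equivalence of categories
[compatible with the functors to the respective elementary Frobenioids] between `(C^pf)^un-tr` and `(C^un-tr)^pf`";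
Theorem 6.4 (iii) p. 114 l. 44 – p. 115 l. 2, verbatim: "If the equivalence of categories `Ψ^rlf` of (ii) arises from
an equivalence of categories `(Ψ^pf)^un-tr : (C₁^pf)^un-tr ⥲ (C₂^pf)^un-tr` between the unit-trivialized perfections of
`C₁`, `C₂` [cf. (i); Corollary 5.4], then …".
[cite: MochizukiFrdI2008, Prop. 5.3 p.103] [cite: MochizukiFrdI2008, Prop. 5.5 (ii) p.104]
[cite: MochizukiFrdI2008, Thm. 6.4 (iii) p.114]

PROOF-ONLY companion (cell abc-iut, seat abc-iut-L1-d1 gen 5; row «T64iii COMPARISON FUNCTORS AT THE DATA» = the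
LAST binders of the arbitrary-`Ψ′` chain of Thm. 6.4 (iii): abc-iut-L1-t3's knit
`Thm64iii_arith_general_of_transportCompat` (`ArithmeticFrobenioidThm64iiiGeneral.lean`) and abc-iut-L1-d2's (G2′)
adapter `arith_hG2_of_square` (`ArithmeticFrobenioidThm64iiiTransportCompatArith.lean`) quantify over "comparison
functors" `u_i : ((C_i)^pf)^un-tr → C_i^rlf` lying over `D_i` up to `β_i : u_i ⋙ Base ≅ Base` and satisfying the
Div-clause `Div(u_i φ) = β_i^* ι(Div φ)`, `ι : Φ^pf → Φ^rlf`).  This file DISCHARGES those binders at THE data: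
for THE arithmetic Frobenioid `C_{K/F}` of Ex. 6.3 and every `hΦ` there EXISTS such a triple `(u, β, hu)` in the
EXACT binder letter of the adapter, with `u` THE composite of print's functors

  `((C)^pf)^un-tr ⥲ ((C)^un-tr)^pf` (Prop. 5.5 (ii), THE comparison functor `PreFrobenioid.PerfectionUntr.comparison`,
  compatible with the functors to `F_{Φ^pf}`: `PreFrobenioid.prop55ii_untr_elem'`)
  `⥲ untrPfModel` (Prop. 5.3 "`(C^un-tr)^pf` … may be obtained as the model Frobenioid associated to … `Φ^pf` … and …
  `ℚ · Φ^birat`", compatible with the functors to `F_{Φ^pf}`: abc-iut-L1-d5's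
  `arith_exists_untrPf_equiv_untrPfModel_elem`)
  `→ C^rlf` (the last arrow of the bottom row of Prop. 5.3, abc-iut-L1-d2's `PreFrobenioid.untrPfToRlf`, lying over
  `F_{Φ^pf} → F_{Φ^rlf}` ON THE NOSE: `ModelFrobenioid.DataHom.functorCompToElem`).

* §1 (generic, Def. 1.1 (iii)/(iv)) `PreFrobenioidData.exists_baseIso_divClause_of_natIso` — for functors
  `G_i : C_i → F_{Φ_i}` over one base `D`, `τ : Φ₁ → Φ₂` with `Φ₂` sharp, `u : C₁ → C₂` and an isomorphism
  `ω : u ⋙ G₂ ≅ G₁ ⋙ F_τ`: a base isomorphism `β : u ⋙ Base ≅ Base` (components `Base(ω_A)`) with the Div-clause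
  `Div(u φ) = β_A^* τ(Div φ)` and `deg_Fr(u φ) = deg_Fr(φ)` for the operations `PreFrobenioidData.ofFunctor _ G_i`
  (abc-iut-L1-t10's `ElemFrobenioid.div_map_eq_of_natIso` / `degFr_map_eq_of_natIso`);
* §2 `arith_exists_pfUntrToRlf_compToElem` — THE composite `u` with `u ⋙ (C^rlf → F_{Φ^rlf}) ≅ (((C)^pf)^un-tr → F_{Φ^pf})
  ⋙ F_ι`, `ι = Φ^pf → Φ^rlf` (`RealificationData.pfToRlfNatTrans`);
* §2 **`arith_exists_comparisonFunctor_pfUntr_rlf`** — `∃ u β, ∀ φ, Div(u φ) = β_A^* ι(Div φ)` in the binder letter of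
  `arith_hG2_of_square` (`SU = ofFunctor _ (untrFunctor (arith_pf_isFrobenioid F K))`,
  `SR = (arithRealification hΦ).ops`, `ι = (IsPerfFactorialOn.op hΦ (op _)).toRealification`), and
  `arith_exists_comparisonFunctor_pfUntr_rlf_degFr` (the same `u` also preserves Frobenius degrees).

So in the arbitrary-`Ψ′` form of Thm. 6.4 (iii) the only remaining input is print's own hypothesis "arises from"
(the `1`-commutative square `σ : Ψ′ ⋙ u₂ ≅ u₁ ⋙ Ψ^rlf`).  No `def`, no instance, no notation, no named fact; nothing
printed is strengthened or weakened.  Honest framing: kernel bookkeeping for a refereed 2008 statement ([FrdI]);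
nothing here bears on, or takes a side on, [IUTchIII] Cor. 3.12.
-/

noncomputable section

namespace Literature.AlgebraicGeometry.Frobenioids

open CategoryTheory Opposite

/-! ### §1 Base isomorphism and Div-clause along an isomorphism of functors over `F_τ : F_{Φ₁} → F_{Φ₂}` -/

namespace PreFrobenioidData

section NatIso

universe w v v₁ v₂ u u₁ u₂

variable {D : Type u} [Category.{v} D] {Φ₁ Φ₂ : Dᵒᵖ ⥤ CommMonCat.{w}}
  {C₁ : Type u₁} [Category.{v₁} C₁] {C₂ : Type u₂} [Category.{v₂} C₂]
  (G₁ : C₁ ⥤ ElemFrobenioid Φ₁) (G₂ : C₂ ⥤ ElemFrobenioid Φ₂) (τ : Φ₁ ⟶ Φ₂)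
  (u : C₁ ⥤ C₂) (ω : u ⋙ G₂ ≅ G₁ ⋙ ElemFrobenioid.mapNatTrans τ)

/-- **Def. 1.1 (iii)/(iv): a functor `u : C₁ → C₂` lying over `F_τ : F_{Φ₁} → F_{Φ₂}` up to an isomorphism
`ω : u ⋙ G₂ ≅ G₁ ⋙ F_τ` lies over `D` up to the base isomorphism `β = Base(ω)` and, when `Φ₂` is sharp, satisfies the
Div-clause `Div(u φ) = β_A^* τ(Div φ)`; it preserves Frobenius degrees** (isomorphisms of `F_{Φ₂}` have Frobenius degree
`1` and unit, hence trivial, zero divisor; then the composition law of Def. 1.1 (iii)).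
[cite: MochizukiFrdI2008, Def. 1.1 (iii) p.19] -/
theorem exists_baseIso_divClause_of_natIso (hΦ₂ : ∀ (A : D) (x : Φ₂.obj (op A)), IsUnit x → x = 1) :
    ∃ β : u ⋙ (ofFunctor Φ₂ G₂).base ≅ (ofFunctor Φ₁ G₁).base,
      (∀ A : C₁, β.hom.app A = ElemFrobenioid.Base (ω.hom.app A)) ∧
      (∀ ⦃A B : C₁⦄ (φ : A ⟶ B), (ofFunctor Φ₂ G₂).div (u.map φ) =
        (ofFunctor Φ₂ G₂).pull (β.hom.app A)
          ((τ.app (op ((ofFunctor Φ₁ G₁).base.obj A))).hom ((ofFunctor Φ₁ G₁).div φ))) ∧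
      ∀ ⦃A B : C₁⦄ (φ : A ⟶ B), (ofFunctor Φ₂ G₂).degFr (u.map φ) = (ofFunctor Φ₁ G₁).degFr φ := by
  refine ⟨NatIso.ofComponents (fun A => (ElemFrobenioid.baseFunctor Φ₂).mapIso (ω.app A)) ?_, fun A => rfl,
    fun A B φ => ?_, fun A B φ => ?_⟩
  · intro A B φ
    exact ElemFrobenioid.base_map_natIso ω φ
  · exact ElemFrobenioid.div_map_eq_of_natIso hΦ₂ ω φ
  · exact ElemFrobenioid.degFr_map_eq_of_natIso ω φ

end NatIso

end PreFrobenioidData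

/-! ### §2 THE comparison functor `((C_{K/F})^pf)^un-tr → C_{K/F}^rlf` -/

section Arith

open PreFrobenioid Literature.AnabelianGeometry.EtaleTheta

variable {F : Type} [Field F] [NumberField F] {K : Type} [Field K] [Algebra F K] [IsGalois F K]
  (hΦ : PreFrobenioid.IsPerfFactorialOn (arithDivisorFunctor F K))

/-- **THE composite `((C)^pf)^un-tr ⥲ ((C)^un-tr)^pf ⥲ untrPfModel → C^rlf` of Prop. 5.3 / Prop. 5.5 (ii) at `C_{K/F}`
lies over `F_ι : F_{Φ^pf} → F_{Φ^rlf}`** (`ι = Φ^pf → Φ^rlf`): there is a functor `u : ((C_{K/F})^pf)^un-tr → C_{K/F}^rlf`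
— THE comparison functor `(C^pf)^un-tr ⥲ (C^un-tr)^pf` followed by THE identification with the model of
`(Φ^pf, ℚ · Φ^birat)` followed by THE functor to the model of `(Φ^rlf, ℝ · Φ^birat)` — with
`u ⋙ (C^rlf → F_{Φ^rlf}) ≅ ((C^pf)^un-tr → F_{Φ^pf}) ⋙ F_ι`. [cite: MochizukiFrdI2008, Prop. 5.3 p.103] -/
theorem arith_exists_pfUntrToRlf_compToElem :
    ∃ u : (PreFrobenioidData.ofFunctor _
          (Perfection.ops (arithFrobenioid_isFrobenioid F K)).toFunctor).Untr ⥤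
        PreFrobenioid.rlf (ModelFrobenioid.toElem (arithDivisorFunctor F K) (unitsFunctor F K) (divNatTrans F K)) hΦ,
      Nonempty (u ⋙ rlfToElem _ hΦ ≅
        untrFunctor (arith_pf_isFrobenioid F K) ⋙
          ElemFrobenioid.mapNatTrans
            (RealificationData.pfToRlfNatTrans (arithDivisorFunctor F K) (IsPerfFactorialOn.op hΦ))) := by
  -- Prop. 5.5 (ii): THE comparison functor `(C^pf)^un-tr ⥲ (C^un-tr)^pf`, over `F_{Φ^pf}`
  obtain ⟨e₁, ⟨ω₁⟩⟩ := prop55ii_untr_elem' (arithFrobenioid_isFrobenioid F K)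
    (arith_isOfType_isFrobeniusIsotropic F K)
  -- Prop. 5.3: `(C^un-tr)^pf ⥲` the model of `(Φ^pf, ℚ · Φ^birat)`, over `F_{Φ^pf}` (abc-iut-L1-d5)
  obtain ⟨e₂, ⟨ω₂⟩, -⟩ := arith_exists_untrPf_equiv_untrPfModel_elem F K
  -- Prop. 5.3: the model of `(Φ^pf, ℚ · Φ^birat)` `→ C^rlf`, over `F_ι` on the nose (abc-iut-L1-d2)
  let ω₃ := ((RealificationData.canonical (arithDivisorFunctor F K) (IsPerfFactorialOn.op hΦ)).pfToRlfData
    (biratSubfunctor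
      (ModelFrobenioid.toElem (arithDivisorFunctor F K) (unitsFunctor F K) (divNatTrans F K)))).functorCompToElem
  refine ⟨e₁.functor ⋙ e₂.functor ⋙ untrPfToRlf _ hΦ, ⟨?_⟩⟩
  exact Functor.associator _ _ _ ≪≫
    Functor.isoWhiskerLeft e₁.functor
      (Functor.associator _ _ _ ≪≫ Functor.isoWhiskerLeft e₂.functor ω₃ ≪≫ (Functor.associator _ _ _).symm ≪≫
        Functor.isoWhiskerRight ω₂ _) ≪≫
    (Functor.associator _ _ _).symm ≪≫ Functor.isoWhiskerRight ω₁ _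

/-- **THE comparison functor `u : ((C_{K/F})^pf)^un-tr → C_{K/F}^rlf` of Prop. 5.3 / Thm. 6.4 (iii) with its base
isomorphism `β : u ⋙ Base ≅ Base` and Div-clause `Div(u φ) = β_A^* ι(Div φ)`** (`ι : Φ^pf(L) → Φ^rlf(L)` the
factorization homomorphism of Def. 2.4 (i)) — in the EXACT letter of the binders `(u_i, β_i, hu_i)` of abc-iut-L1-d2's
`arith_hG2_of_square` / abc-iut-L1-t3's `Thm64iii_arith_general_of_transportCompat`: they are INSTANTIATED at THE
constructions ("the functors that arise naturally from the construction", Prop. 5.3; "arises from … [cf. (i); Corollary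
5.4]", Thm. 6.4 (iii)). [cite: MochizukiFrdI2008, Thm. 6.4 (iii) p.114] -/
theorem arith_exists_comparisonFunctor_pfUntr_rlf :
    ∃ (u : (PreFrobenioidData.ofFunctor _
          (Perfection.ops (arithFrobenioid_isFrobenioid F K)).toFunctor).Untr ⥤
        PreFrobenioid.rlf (ModelFrobenioid.toElem (arithDivisorFunctor F K) (unitsFunctor F K) (divNatTrans F K)) hΦ)
      (β : u ⋙ (arithRealification hΦ).ops.base ≅
        (PreFrobenioidData.ofFunctor _ (untrFunctor (arith_pf_isFrobenioid F K))).base),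
      ∀ ⦃A B : (PreFrobenioidData.ofFunctor _
          (Perfection.ops (arithFrobenioid_isFrobenioid F K)).toFunctor).Untr⦄ (φ : A ⟶ B),
        (arithRealification hΦ).ops.div (u.map φ) =
          (arithRealification hΦ).ops.pull (β.hom.app A)
            ((IsPerfFactorialOn.op hΦ (op _)).toRealification
              ((PreFrobenioidData.ofFunctor _ (untrFunctor (arith_pf_isFrobenioid F K))).div φ)) := by
  obtain ⟨u, ⟨ω⟩⟩ := arith_exists_pfUntrToRlf_compToElem hΦ
  obtain ⟨β, -, hdiv, -⟩ := PreFrobenioidData.exists_baseIso_divClause_of_natIso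
    (untrFunctor (arith_pf_isFrobenioid F K)) (rlfToElem _ hΦ)
    (RealificationData.pfToRlfNatTrans (arithDivisorFunctor F K) (IsPerfFactorialOn.op hΦ)) u ω
    (fun A x hx => (IsPerfFactorial.Rlf.isSharp (IsPerfFactorialOn.op hΦ (op A))).eq_one_of_isUnit x hx)
  exact ⟨u, β, hdiv⟩

/-- The same comparison functor also preserves Frobenius degrees (`deg_Fr(u φ) = deg_Fr(φ)`) — recorded together with
the base isomorphism and the Div-clause, i.e. `u` lies over `F_ι : F_{Φ^pf} → F_{Φ^rlf}` in all three coordinates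
`(Base, Div, deg_Fr)` of Def. 1.1 (iii). [cite: MochizukiFrdI2008, Prop. 5.3 p.103] -/
theorem arith_exists_comparisonFunctor_pfUntr_rlf_degFr :
    ∃ (u : (PreFrobenioidData.ofFunctor _
          (Perfection.ops (arithFrobenioid_isFrobenioid F K)).toFunctor).Untr ⥤
        PreFrobenioid.rlf (ModelFrobenioid.toElem (arithDivisorFunctor F K) (unitsFunctor F K) (divNatTrans F K)) hΦ)
      (β : u ⋙ (arithRealification hΦ).ops.base ≅
        (PreFrobenioidData.ofFunctor _ (untrFunctor (arith_pf_isFrobenioid F K))).base),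
      (∀ ⦃A B : (PreFrobenioidData.ofFunctor _
          (Perfection.ops (arithFrobenioid_isFrobenioid F K)).toFunctor).Untr⦄ (φ : A ⟶ B),
        (arithRealification hΦ).ops.div (u.map φ) =
          (arithRealification hΦ).ops.pull (β.hom.app A)
            ((IsPerfFactorialOn.op hΦ (op _)).toRealification
              ((PreFrobenioidData.ofFunctor _ (untrFunctor (arith_pf_isFrobenioid F K))).div φ))) ∧
      ∀ ⦃A B : (PreFrobenioidData.ofFunctor _
          (Perfection.ops (arithFrobenioid_isFrobenioid F K)).toFunctor).Untr⦄ (φ : A ⟶ B),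
        (arithRealification hΦ).ops.degFr (u.map φ) =
          (PreFrobenioidData.ofFunctor _ (untrFunctor (arith_pf_isFrobenioid F K))).degFr φ := by
  obtain ⟨u, ⟨ω⟩⟩ := arith_exists_pfUntrToRlf_compToElem hΦ
  obtain ⟨β, -, hdiv, hdeg⟩ := PreFrobenioidData.exists_baseIso_divClause_of_natIso
    (untrFunctor (arith_pf_isFrobenioid F K)) (rlfToElem _ hΦ)
    (RealificationData.pfToRlfNatTrans (arithDivisorFunctor F K) (IsPerfFactorialOn.op hΦ)) u ω
    (fun A x hx => (IsPerfFactorial.Rlf.isSharp (IsPerfFactorialOn.op hΦ (op A))).eq_one_of_isUnit x hx)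
  exact ⟨u, β, hdiv, hdeg⟩

end Arith

end Literature.AlgebraicGeometry.Frobenioids

end
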